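import Literature.NumberTheory.EllipticCurves.Castella2018.SigmaSelmerUnramifiedOutsideS
import Literature.NumberTheory.EllipticCurves.PrimaryTorsionFrobeniusUnramifiedProofs
import Literature.NumberTheory.EllipticCurves.BigRepModuleFrobeniusSurjectiveProofs
import Literature.NumberTheory.GaloisRepresentations.LocalHOneInertiaRestrictionProfinite
import HarnessLib

/-!
# Proof of Castella 2018 §2.2 / Erratum Lemma 2.1: `Sel^Σ_𝔭(K, T_pE ⊗ Λ^*)` of Def. 2.2 IS the
# `G_{K,S}`-kernel when `Σ ⊇ {w ∤ p : T ramified at w}` — discharge of the named fact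
# `Castella2018.selmerBig_eq_selmerBigDecomp_of_unramifiedOutside`

`Proofs` file (theorems only: no definition, no named fact, no instance; D-0026) in topic
`NumberTheory/EllipticCurves/Castella2018`, sibling of `SigmaSelmerUnramifiedOutsideS`, whose named
fact `selmerBig_eq_selmerBigDecomp_of_unramifiedOutside` it discharges
(**`selmerBig_eq_selmerBigDecomp_of_unramifiedOutside_holds`**, at the end).  Plan of record:
`pub/bsd-cited/sheets/NOTE-r17-SigmaBridge-discharge-plan-df9ef7a3.md` (modules M1 + M4; M2 =
`BigRepModuleFrobeniusSurjectiveProofs`, M3 = `PrimaryTorsionFrobeniusUnramifiedProofs`).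

## The printed argument (F. Castella, Camb. J. Math. 6 (2018), §2.2 [arXiv:1704.06608 TeX p. 7]; Erratum, proof of Lemma 2.1)

"Note that directly from the definition we have an exact sequence
`0 → Sel_𝔭(K_∞, E[p^∞]) → 𝔖el_Gr(K_∞, E[p^∞]) → ℋ^ur_𝔭 ⊕ ∏_{w∤p} ℋ^ur_w`, where
`ℋ^ur_v = ker{H¹(K_v, M) → H¹(I_v, M)}` is the set of unramified cocycles. … For primes `v ∤ p` which
are split in `K`, it is easy to see that the restriction map `H¹(K_v, M) → H¹(I_v, M)` is injective
(see [PW11]), and so `ℋ^ur_v` vanishes. … `ℋ^ur_w ≃ (ℤ_p/p^{t_E(w)}ℤ_p) ⊗ Λ^*`, where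
`t_E(w) := ord_p(c_w(E/K))`" (so `ℋ^ur_w = 0` at a good `w`); Thm. 2.6: "assume that `Σ ∪ S_p`
contains all places of `K` at which `T` is ramified … our assumption on `S := Σ ∪ S_p` implies that
`Sel^Σ_𝔭(K_∞, M) = ker{H¹(G_{K,S}, M) → H¹(K_𝔭, M)/…}`".

## The proof given here

For `M = T_pE ⊗ Λ^*(Ψ⁻¹)` in the co-induced model (`anticyclotomicBigRep`: smooth `E[p^∞]`-valued
functions on `ℤ_p`, `(g·Φ)(x) = ρ(g)(Φ(x − κ g))`) and a finite place `w ∉ Σ`, `w ∤ p`: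

* §1 (formal half, any `ContinuousRep`): a class dying in `H¹(K_w, M)` dies in `H¹(I_w, M)`
  (`resH1_comp_eq_zero_of_resH1_eq_zero`: restriction along `I_w ↪ Γ_{K_w} → Γ_K` factors; on
  cocycles by `map_oneCocycleClass` / `oneCocycleClass_eq_zero_iff`).
* §2 (the content, `ℋ^ur_w(M) = 0`; any `ContinuousRep ρ` of `Γ_K` on a discrete module): if
  `I_w` acts trivially on `M` and `Frob_w − 1` is SURJECTIVE on `M` for one arithmetic Frobenius lift,
  then a class of `H¹(Γ_K, M)` dying in `H¹(I_w, M)` dies in `H¹(K_w, M)`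
  (`resH1_eq_zero_of_resH1_comp_inertiaIncl_eq_zero`): a representative cocycle restricted to
  `Γ_{K_w}` is a coboundary on `I_w`, hence VANISHES on `I_w` (trivial action), and the tree's
  unramified-class criterion `oneCocycleClass_eq_zero_iff_of_vanishing_absInertia`
  (`LocalHOneInertiaRestrictionProfinite`: `[z] = 0 ↔ z(φ) ∈ (φ − 1)M^{I_w}`) applies because
  `(φ − 1)M = M`.
* §3 the inputs for `M = T_pE ⊗ Λ^*`: `I_w` acts trivially (`ρ_E(I_w) = 1` is the fact's hypothesis
  `hram`; `κ(I_w) = 1`, `ZpExtension.apply_localMap_inr`), and `Frob_w − 1` is onto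
  (`BigRepModule.bigRep_sub_self_surjective`, M2, fed with `E[p^∞]` `p`-divisible —
  `smul_surjective_primaryTorsion` —, `p ≠ 2`, and the Cayley–Hamilton relation
  `ρ(g)² = a_w ρ(g) − q_w` on `E[p^∞]` with `q_w ≥ 2`, `a_w ≠ q_w + 1` —
  `primaryTorsionGaloisRep_sq_eq_of_isFrobPow` etc., M3 —, good reduction at `w` coming from `hram`
  by Néron–Ogg–Shafarevich (d) ⇒ (a), `hasGoodReductionAt_of_primaryTorsionGaloisRep_localMap_inr_eq`).
* §4 assembly: the two strict sets `strictSet` / `strictSetDecomp` cut out the same submodule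
  (`le_antisymm`; at `Sum.inl 𝔮` the conditions coincide).

No Hasse bound, no split/inert distinction; the fact's hypotheses `Irr`, `IsImaginaryQuadratic`,
`SatisfiesHeegnerHypothesis`, `IsAnticyclotomic`, `S.Finite` are not used (the statement is the
tree's, untouched).  All axioms standard.

References: [Castella2018] §2.2 ((eq:defs), the two `ℋ^ur` sentences), Thm. 2.6 and its proof;
[Castella2018Erratum] §2, proof of Lemma 2.1 (p. 2); [PollackWeston2011AMU] §3 (as cited by
[Castella2018]); [SerreLocalFields1979] XIII §1 Prop. 1; [SilvermanAEC2009] VII.7.1, C.21.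
-/

noncomputable section

open Field IsDedekindDomain NumberField WeierstrassCurve
open Literature.NumberTheory.EllipticCurves Literature.NumberTheory.EllipticCurves.BigGaloisRep
open Literature.NumberTheory.EllipticCurves.Rank1Residual
open Literature.NumberTheory.GaloisRepresentations

universe u

namespace Literature.NumberTheory.EllipticCurves.Castella2018

/-! ### §1. Formal half: dying in `H¹(H, M)` implies dying in `H¹(H', M)` for `H' → H → Γ` -/

section Formal

variable {A : Type*} [CommRing A] [TopologicalSpace A]
variable {Γ : Type u} [Group Γ] [TopologicalSpace Γ] [IsTopologicalGroup Γ]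
variable {H : Type u} [Group H] [TopologicalSpace H] [IsTopologicalGroup H]
variable {H' : Type u} [Group H'] [TopologicalSpace H'] [IsTopologicalGroup H']
variable {M : Type u} [AddCommGroup M] [Module A M] [TopologicalSpace M] [DiscreteTopology M]
  [ContinuousSMul A M]

/-- **Restriction along a composite factors through zero**: if a class of `H¹(Γ, M)` restricts to
zero along `θ : H → Γ`, it restricts to zero along `θ ∘ ψ : H' → H → Γ` (for `θ` a decomposition
group and `ψ` the inclusion of its inertia group: a class trivial at `w` is unramified at `w`).
On cocycles: `z ∘ θ = ∂v` on `H` gives `z ∘ θ ∘ ψ = ∂v` on `H'`.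
[cite: SerreGaloisCohomology1997, I §2.4 (functoriality of restriction)] -/
theorem resH1_comp_eq_zero_of_resH1_eq_zero (ρ : ContinuousRep Γ A M) (θ : H →ₜ* Γ) (ψ : H' →ₜ* H)
    (x : continuousCohomology 1 ρ.toTopRep) (hx : resH1 ρ θ x = 0) :
    resH1 ρ (θ.comp ψ) x = 0 := by
  obtain ⟨z, rfl⟩ := oneCocycleClass_surjective ρ.toTopRep x
  rw [resH1, map_oneCocycleClass, oneCocycleClass_eq_zero_iff] at hx ⊢
  obtain ⟨v, hv⟩ := hx
  exact ⟨v, fun h ↦ hv (ψ h)⟩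

end Formal

/-! ### §2. The content: `ℋ^ur_w(M) = 0` when `I_w` acts trivially and `Frob_w − 1` is onto -/

section Unramified

variable {K : Type u} [Field K] [NumberField K]
variable {A : Type u} [CommRing A] [TopologicalSpace A]
variable {M : Type u} [AddCommGroup M] [Module A M] [TopologicalSpace M] [DiscreteTopology M]
  [ContinuousSMul A M]

/-- **A class of `H¹(Γ_K, M)` unramified at `w` is trivial at `w`, when `I_w` acts trivially on `M`
and `Frob_w − 1` is surjective on `M`** (`ℋ^ur_w = ker{H¹(K_w, M) → H¹(I_w, M)} = 0`).  For a
continuous representation `ρ` of `Γ_K` on a discrete `M`, a finite place `w`, the chosen restriction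
`Γ_{K_w} → Γ_K` (`localMap K (Sum.inl w)`) and its composite with `I_{K_w} ↪ Γ_{K_w}`
(`localMap K (Sum.inr w)`): if every `σ ∈ I_{K_w}` acts as the identity, and `ρ(φ) − 1` is onto for an
arithmetic Frobenius lift `φ ∈ Γ_{K_w}`, then `res_{I_w} x = 0 ⇒ res_w x = 0`.  Proof on cocycles:
`x = [z]`; `res_{I_w}[z] = 0` says `z ∘ res` is a coboundary `∂v` on `I_{K_w}`, i.e. VANISHES there
(`σv = v`); by the tree's criterion for `I`-vanishing cocycles
(`oneCocycleClass_eq_zero_iff_of_vanishing_absInertia`: `[z] = 0 ↔ z(φ) ∈ (φ − 1)M^{I}`), and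
`(φ − 1)M = M = M^{I}`, the class of `z ∘ res` on `Γ_{K_w}` is zero.  This is the mechanism of
"`ℋ^ur_v` vanishes" / "`ℋ^ur_w ≃ (ℤ_p/p^{t_E(w)}) ⊗ Λ^*`" with `t_E(w) = 0`.
[cite: Castella2018, §2.2 (the two sentences on ℋ^ur_v, ℋ^ur_w after Prop. 2.5)]
[cite: SerreLocalFields1979, XIII §1 Prop. 1] -/
theorem resH1_localMap_inl_eq_zero_of_inr (ρ : ContinuousRep (absoluteGaloisGroup K) A M)
    (w : HeightOneSpectrum (𝓞 K))
    (hI : ∀ (σ : LocalGroup K (Sum.inr w)) (m : M), ρ (localMap K (Sum.inr w) σ) m = m)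
    {φ : absoluteGaloisGroup (w.adicCompletion K)} (hφ : IsFrobPow φ 1)
    (hsurj : Function.Surjective fun m : M ↦ ρ (localMap K (Sum.inl w) φ) m - m)
    (x : continuousCohomology 1 ρ.toTopRep) (hx : resH1 ρ (localMap K (Sum.inr w)) x = 0) :
    resH1 ρ (localMap K (Sum.inl w)) x = 0 := by
  obtain ⟨z, rfl⟩ := oneCocycleClass_surjective ρ.toTopRep x
  rw [resH1, map_oneCocycleClass, oneCocycleClass_eq_zero_iff] at hx
  obtain ⟨v, hv⟩ := hx
  -- `z` vanishes on `I_w` (a coboundary for a trivial action is zero)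
  have hz : ∀ n : absInertia (w.adicCompletion K),
      (contOneCocycles.pullback (localMap K (Sum.inl w)) (resMod ρ (localMap K (Sum.inl w))) z).1
        (n : absoluteGaloisGroup (w.adicCompletion K)) = 0 := by
    intro n
    have h := hv n
    rw [contOneCocycles.pullback_apply, resMod_hom_apply] at h
    -- `localMap K (Sum.inr w) n = localMap K (Sum.inl w) ↑n` definitionally
    change z.1 (localMap K (Sum.inr w) n) = 0
    rw [h, sub_eq_zero]
    exact hI n v
  rw [resH1, map_oneCocycleClass]
  refine (oneCocycleClass_eq_zero_iff_of_vanishing_absInertia (w.adicCompletion K)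
    (ρ.restrict (localMap K (Sum.inl w))).toTopRep
    ((ρ.restrict (localMap K (Sum.inl w))).continuous_apply₂) hφ _ hz).mpr ?_
  obtain ⟨m, hm⟩ := hsurj ((contOneCocycles.pullback (localMap K (Sum.inl w))
    (resMod ρ (localMap K (Sum.inl w))) z).1 φ)
  exact ⟨m, fun n ↦ hI n m, hm.symm⟩

end Unramified

/-! ### §3. The inputs for `M = T_pE ⊗ Λ^*(Ψ⁻¹)` at a place `w ∉ Σ`, `w ∤ p` -/

section BigRep

variable {K : Type} [Field K] [NumberField K] (E : WeierstrassCurve K) [E.IsElliptic]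
  (p : ℕ) [Fact p.Prime] (κ : ZpExtension K p)
  [TopologicalSpace (IwasawaAlgebra p)]
  [ContinuousSMul (IwasawaAlgebra p) (BigRepModule ℤ_[p] p (PrimaryTorsion (geomPoints E) p))]

omit [E.IsElliptic]
  [ContinuousSMul (IwasawaAlgebra p) (BigRepModule ℤ_[p] p (PrimaryTorsion (geomPoints E) p))] in
/-- **`I_w` acts trivially on `T_pE ⊗ Λ^*(Ψ⁻¹)`** at `w ∤ p` when it acts trivially on `E[p^∞]`:
`(σ·Φ)(x) = ρ(σ)(Φ(x − κ σ)) = Φ(x)` because `κ(σ) = 0` (`ℤ_p`-extensions are unramified outside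
`p`, `ZpExtension.apply_localMap_inr`) and `ρ(σ) = 1` on `E[p^∞]` (hypothesis).
[cite: Castella2018, Thm. 2.6 ("assume that Σ ∪ S_p contains all places of K at which T is ramified")]
[cite: Washington1997, Prop. 13.2] -/
theorem anticyclotomicBigRep_localMap_inr_apply {w : HeightOneSpectrum (𝓞 K)}
    (hpw : ((p : ℕ) : 𝓞 K) ∉ w.asIdeal)
    (hram : ∀ (σ : LocalGroup K (Sum.inr w)) (P : PrimaryTorsion (geomPoints E) p),
      E.primaryTorsionGaloisRep p (localMap K (Sum.inr w) σ) P = P)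
    (σ : LocalGroup K (Sum.inr w)) (Φ : BigRepModule ℤ_[p] p (PrimaryTorsion (geomPoints E) p)) :
    E.anticyclotomicBigRep p κ (localMap K (Sum.inr w) σ) Φ = Φ := by
  refine DFunLike.ext _ _ fun x ↦ ?_
  change bigRep κ.toContinuousMonoidHom (E.primaryTorsionGaloisRep p) (localMap K (Sum.inr w) σ) Φ x
    = Φ x
  rw [bigRep_apply_apply, ZpExtension.coe_toContinuousMonoidHom,
    ZpExtension.apply_localMap_inr κ hpw σ, toAdd_one, sub_zero, hram]

omit [ContinuousSMul (IwasawaAlgebra p) (BigRepModule ℤ_[p] p (PrimaryTorsion (geomPoints E) p))] in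
/-- **`Frob_w − 1` is SURJECTIVE on `T_pE ⊗ Λ^*(Ψ⁻¹)`** at a place `w ∤ p` (`p ≠ 2`) where `I_w`
acts trivially on `E[p^∞]`, for every arithmetic Frobenius lift `φ ∈ Γ_{K_w}`: good reduction at
`w` by Néron–Ogg–Shafarevich (`hasGoodReductionAt_of_primaryTorsionGaloisRep_localMap_inr_eq`), the
Cayley–Hamilton relation `ρ(φ)² = a_w ρ(φ) − q_w` on `E[p^∞]`
(`primaryTorsionGaloisRep_sq_eq_of_isFrobPow`) with `q_w ≠ ±1`, `a_w ≠ q_w + 1`, `E[p^∞]`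
`p`-divisible (`smul_surjective_primaryTorsion`), and the engine
`BigRepModule.bigRep_sub_self_surjective`.  ("`ℋ^ur_v` vanishes"; "`ℋ^ur_w ≃ (ℤ_p/p^{t_E(w)}) ⊗ Λ^*`"
with `t_E(w) = 0` at a good `w`.)
[cite: Castella2018, §2.2 (the two sentences on ℋ^ur_v, ℋ^ur_w after Prop. 2.5)] -/
theorem anticyclotomicBigRep_sub_self_surjective (hp2 : p ≠ 2) {w : HeightOneSpectrum (𝓞 K)}
    (hpw : ((p : ℕ) : 𝓞 K) ∉ w.asIdeal)
    (hram : ∀ (σ : LocalGroup K (Sum.inr w)) (P : PrimaryTorsion (geomPoints E) p),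
      E.primaryTorsionGaloisRep p (localMap K (Sum.inr w) σ) P = P)
    {φ : absoluteGaloisGroup (w.adicCompletion K)} (hφ : IsFrobPow φ 1) :
    Function.Surjective fun Φ : BigRepModule ℤ_[p] p (PrimaryTorsion (geomPoints E) p) ↦
      E.anticyclotomicBigRep p κ (localMap K (Sum.inl w) φ) Φ - Φ := by
  have hv : E.HasGoodReductionAt w :=
    E.hasGoodReductionAt_of_primaryTorsionGaloisRep_localMap_inr_eq p hpw hram
  exact BigRepModule.bigRep_sub_self_surjective κ.toContinuousMonoidHom (E.primaryTorsionGaloisRep p)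
    hp2 (E.smul_surjective_primaryTorsion p) (w.natCard_residueField_adicCompletionIntegers_ne_one)
    (w.natCard_residueField_adicCompletionIntegers_ne_neg_one) (E.frobeniusTraceAt_ne_natCard_add_one w)
    (localMap K (Sum.inl w) φ) (primaryTorsionGaloisRep_sq_eq_of_isFrobPow hpw hv hφ)

/-- **`ℋ^ur_w(T_pE ⊗ Λ^*) = 0`**: at a finite place `w ∤ p` (`p ≠ 2`) at which `I_w` acts trivially
on `E[p^∞]`, a class of `H¹(Γ_K, T_pE ⊗ Λ^*(Ψ⁻¹))` unramified at `w` is trivial at `w`.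
[cite: Castella2018, §2.2 (the two sentences on ℋ^ur_v, ℋ^ur_w after Prop. 2.5) and Thm. 2.6 with its proof] -/
theorem resH1_anticyclotomicBigRep_localMap_inl_eq_zero_of_inr (hp2 : p ≠ 2)
    {w : HeightOneSpectrum (𝓞 K)} (hpw : ((p : ℕ) : 𝓞 K) ∉ w.asIdeal)
    (hram : ∀ (σ : LocalGroup K (Sum.inr w)) (P : PrimaryTorsion (geomPoints E) p),
      E.primaryTorsionGaloisRep p (localMap K (Sum.inr w) σ) P = P)
    (x : continuousCohomology 1 (E.anticyclotomicBigRep p κ).toTopRep)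
    (hx : resH1 (E.anticyclotomicBigRep p κ) (localMap K (Sum.inr w)) x = 0) :
    resH1 (E.anticyclotomicBigRep p κ) (localMap K (Sum.inl w)) x = 0 := by
  obtain ⟨φ, hφa⟩ := exists_isAbsArithFrob_holds (F := w.adicCompletion K)
  have hφ : IsFrobPow φ 1 := IsAbsArithFrob.isFrobPow_holds hφa
  exact resH1_localMap_inl_eq_zero_of_inr (E.anticyclotomicBigRep p κ) w
    (anticyclotomicBigRep_localMap_inr_apply E p κ hpw hram) hφ
    (anticyclotomicBigRep_sub_self_surjective E p κ hp2 hpw hram hφ) x hx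

end BigRep

/-! ### §4. Assembly: the discharge -/

/-- **Castella 2018 §2.2 / Erratum, proof of Lemma 2.1 — PROVED**: for `E/ℚ`, `p ≥ 5`, `K` a number
field, `𝔭 ∣ p`, `Σ` a set of primes `w ∤ p` outside which (and away from `p`) the local inertia groups
act trivially on `E[p^∞]`, and `κ` a `ℤ_p`-extension, the Selmer groups of `T_pE ⊗ Λ^*(Ψ⁻¹)` cut out
by the INERTIA strict set (`selmerBig`: the erratum's `ker{H¹(G_{K,S}, M) → H¹(K_𝔭, M)}`) and by
Def. 2.2's DECOMPOSITION strict set (`selmerBigDecomp`) coincide: `⊆` because `ℋ^ur_w(M) = 0` at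
every `w ∉ Σ`, `w ∤ p` (`resH1_anticyclotomicBigRep_localMap_inl_eq_zero_of_inr`), `⊇` formally
(`resH1_comp_eq_zero_of_resH1_eq_zero`); the conditions at `𝔭` are identical.  Discharge of
`selmerBig_eq_selmerBigDecomp_of_unramifiedOutside` (statement untouched; its hypotheses `Irr`,
imaginary-quadratic, Heegner, anticyclotomic, `Σ` finite are not needed).
[cite: Castella2018, §2.2 ((eq:defs) and the two sentences on ℋ^ur_v, ℋ^ur_w after Prop. 2.5) and Thm. 2.6 with its proof]
[cite: Castella2018Erratum, §2, proof of Lemma 2.1 (p. 2)] -/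
theorem selmerBig_eq_selmerBigDecomp_of_unramifiedOutside_holds :
    selmerBig_eq_selmerBigDecomp_of_unramifiedOutside := by
  intro W _ p _ hp _ K _ _ _ _ 𝔭 _ S _ _ hram κ _ _ _
  have hp2 : p ≠ 2 := by omega
  apply le_antisymm
  · -- `selmerBig ≤ selmerBigDecomp`: the content at the decomposition indices `w ∉ Σ`, `w ∤ p`
    intro x hx
    rw [mem_selmerBig_iff] at hx
    rw [selmerBigDecomp, mem_selmer_iff]
    rintro (w | w) hw
    · rcases (inl_mem_strictSetDecomp_iff p 𝔭 w S).1 hw with rfl | ⟨hwS, hwp⟩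
      · exact hx.1
      · exact resH1_anticyclotomicBigRep_localMap_inl_eq_zero_of_inr (W.baseChange K) p κ hp2 hwp
          (hram w hwS hwp) x (hx.2 w hwS hwp)
    · exact (inr_not_mem_strictSetDecomp p 𝔭 w S hw).elim
  · -- `selmerBigDecomp ≤ selmerBig`: formal
    intro x hx
    rw [selmerBigDecomp, mem_selmer_iff] at hx
    rw [mem_selmerBig_iff]
    refine ⟨hx (Sum.inl 𝔭) ((inl_mem_strictSetDecomp_iff p 𝔭 𝔭 S).2 (Or.inl rfl)),
      fun w hwS hwp ↦ ?_⟩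
    exact resH1_comp_eq_zero_of_resH1_eq_zero _ (localMap K (Sum.inl w)) (inertiaIncl K w) x
      (hx (Sum.inl w) ((inl_mem_strictSetDecomp_iff p 𝔭 w S).2 (Or.inr ⟨hwS, hwp⟩)))

end Literature.NumberTheory.EllipticCurves.Castella2018

end
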